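import Summits.ResolutionOfSingularities.ResolutionOfSingularities.Theorems.WeightedConstruction.Negative.SpecimenGerms

/-!
# Germ caps for the REFUTE-L1 specimen, (B): the twisted-line cap

[OURS · L1 W4.3 · chain w43, seat tri-2] Negative helper lemmas for crux `WeightedConstruction`
(stmt-ResolutionOfSingularities-0571), bearing on the retired line `pointwise-lexmax-hull`
(typed target `lexmaxHullRule_two_isEmpty`, REFUTE-L1 §3b) and on the door card
`certified-lexmax` (its "dead step" at points of the twisted line).  NOT a statement of any
manuscript; no Hironaka statement is used as a premise.  Set-up (`gSpec`, `pointIdeal`,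
`lineIdeal`, `Fq`, `piX`, `rho`, `Phi`) and the order cap (A) are in `SpecimenGerms.lean`.

`g = z⁴ + x²y⁴ + s y⁵ ∈ k[s, z, x, y]` (`X 0 = s`, `X 1 = z`, `X 2 = x`, `X 3 = y`),
`ℓ = V(s, z, y)`, `I_ℓ = (s, z, y)`, `k` ANY field.

* `gSpec_lineIdentity_false`: there is no identity `D · g = H · a + R₅` in `k[s,z,x,y]` with
  `D(c) ≠ 0`, `a ∈ I_ℓ ∖ 𝔪_c²`, `R₅ ∈ I_ℓ⁵` (`c` a `k`-point of `ℓ`).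
* `algebraMap_gSpec_not_mem_span_sup`: in the local ring `S` at `c ∈ ℓ`, for every
  `u₀ ∈ I_ℓ S` with `u₀ ∉ 𝔪²`: `g ∉ (u₀) + I_ℓ⁵ S`.
* `gSpec_weightedMonomialIdeal_lineCap`: for every family `u : Fin m → I_ℓ S` (a chart whose
  support contains `ℓ` near `c`), every index `i₀` with `u i₀ ∉ 𝔪²` (automatic for a member of
  a regular system of parameters) and every bound `W` of the OTHER weights,
  `g ∈ weightedMonomialIdeal u w d → d ≤ 4 * W`.  With `i₀` of maximal weight this caps the
  second-smallest profile entry: every `ℓ`-saturated chart through `g` has profile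
  `≤ (4; 4, …)` — no `ℓ`-supported regular weighted centre presents `g` with second invariant
  entry `> 4`.

Method: apply `Phi` to the identity, cancel one `T`, and read off trailing coefficients in the
domain `k[s,z,x,y][T]`: `piX D · (z⁴ + x²y⁴) = L · M` with `L = p s + q z + r y` the (nonzero)
linear `I_ℓ`-initial form of `a` (`p, q, r ∈ k[x]`); then kill `L` by one of three substitutions
fixing the `x`-line (`(s,z,y) ↦ (-q, p, 0)`, `(0, r, -q)`, `(0, 1, 0)`), which keep `piX D` and
`z⁴ + x²y⁴` nonzero because `r⁴ + x² q⁴ ≠ 0` for `q ≠ 0` (degree parity): `z⁴ + x²y⁴` has no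
factor linear in `(s, z, y)` over `k[x]`.
-/

set_option linter.dupNamespace false

noncomputable section

open Polynomial (X C)
open Literature.AlgebraicGeometry.Resolution

namespace Summit.ResolutionOfSingularities.ResolutionOfSingularities.Theorems.WeightedConstruction.Negative.SpecimenGerms

variable {k : Type*} [Field k]


/-- `C⁴ + x² B⁴ ≠ 0` in `k[x]` for `B ≠ 0` (degree parity): `z⁴ + x²y⁴` has no factor linear in
`(z, y)` over `k[x]`. -/
theorem pow_four_add_X_sq_mul_pow_four_ne_zero {B : Polynomial k} (hB : B ≠ 0)
    (A : Polynomial k) : A ^ 4 + Polynomial.X ^ 2 * B ^ 4 ≠ 0 := by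
  intro h
  have h1 : A ^ 4 = -(Polynomial.X ^ 2 * B ^ 4) := eq_neg_of_add_eq_zero_left h
  have h2 := congrArg Polynomial.natDegree h1
  rw [Polynomial.natDegree_neg, Polynomial.natDegree_pow,
    Polynomial.natDegree_mul (pow_ne_zero _ Polynomial.X_ne_zero) (pow_ne_zero _ hB),
    Polynomial.natDegree_pow, Polynomial.natDegree_pow, Polynomial.natDegree_X] at h2
  omega

/-- **The polynomial heart of (B).** There is no identity `D · g = H · a + R₅` in `k[s,z,x,y]`
with `D(c) ≠ 0`, `a ∈ I_ℓ ∖ 𝔪_c²` and `R₅ ∈ I_ℓ⁵`, at a `k`-point `c` of `ℓ`. -/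
theorem gSpec_lineIdentity_false (c : Fin 4 → k) (hc0 : c 0 = 0) (hc1 : c 1 = 0)
    (hc3 : c 3 = 0) {D a H R5 : MvPolynomial (Fin 4) k} (hD : MvPolynomial.eval c D ≠ 0)
    (ha : a ∈ lineIdeal k) (ha2 : a ∉ pointIdeal k c ^ 2) (hR5 : R5 ∈ lineIdeal k ^ 5)
    (h : D * gSpec k = H * a + R5) : False := by
  classical
  -- write `a = P s + Q z + R₀ y`
  obtain ⟨P, Q, R₀, rfl⟩ : ∃ P Q R₀ : MvPolynomial (Fin 4) k,
      a = P * MvPolynomial.X 0 + Q * MvPolynomial.X 1 + R₀ * MvPolynomial.X 3 := by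
    rw [lineIdeal, Ideal.mem_span_insert] at ha
    obtain ⟨P, z, hz, rfl⟩ := ha
    rw [Ideal.mem_span_insert] at hz
    obtain ⟨Q, z', hz', rfl⟩ := hz
    obtain ⟨R₀, rfl⟩ := Ideal.mem_span_singleton'.mp hz'
    exact ⟨P, Q, R₀, by ring⟩
  -- the restrictions of `P, Q, R₀` to the `x`-line do not all vanish (else `a ∈ 𝔪_c²`)
  have hpqr : ¬ (rho P = 0 ∧ rho Q = 0 ∧ rho R₀ = 0) := by
    rintro ⟨hp0, hq0, hr0⟩
    apply ha2
    have hmem : ∀ G : MvPolynomial (Fin 4) k, rho G = 0 → G ∈ pointIdeal k c := fun G hG => by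
      rw [mem_pointIdeal_iff, ← eval_rho c hc0 hc1 hc3, hG, Polynomial.eval_zero]
    have hX : ∀ i : Fin 4, c i = 0 → (MvPolynomial.X i : MvPolynomial (Fin 4) k) ∈ pointIdeal k c :=
      fun i hi => by rw [mem_pointIdeal_iff, MvPolynomial.eval_X, hi]
    rw [pow_two]
    exact Ideal.add_mem _ (Ideal.add_mem _ (Ideal.mul_mem_mul (hmem P hp0) (hX 0 hc0))
      (Ideal.mul_mem_mul (hmem Q hq0) (hX 1 hc1))) (Ideal.mul_mem_mul (hmem R₀ hr0) (hX 3 hc3))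
  have hd0 : rho D ≠ 0 := by
    intro h0
    apply hD
    rw [← eval_rho c hc0 hc1 hc3, h0, Polynomial.eval_zero]
  have hD0 : piX D ≠ 0 := by
    intro h0
    apply hD
    rw [← eval_piX c hc0 hc1 hc3, h0, map_zero]
  have hFq : (Fq : MvPolynomial (Fin 4) k) ≠ 0 := by
    intro h0
    have := congrArg (MvPolynomial.eval (![0, 1, 0, 0] : Fin 4 → k)) h0
    simp [Fq] at this
  -- apply `Phi` to the identity and cancel one `T`
  obtain ⟨K5, hK5⟩ := X_pow_dvd_Phi_of_mem_lineIdeal_pow 5 hR5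
  have hPhia : Phi (P * MvPolynomial.X 0 + Q * MvPolynomial.X 1 + R₀ * MvPolynomial.X 3) =
      Polynomial.X * (Phi P * C (MvPolynomial.X 0) + Phi Q * C (MvPolynomial.X 1) +
        Phi R₀ * C (MvPolynomial.X 3)) := by
    simp only [map_add, map_mul, Phi_X]
    simp
    ring
  have hPhi := congrArg Phi h
  rw [map_mul, Phi_gSpec, map_add, hK5, map_mul Phi H, hPhia] at hPhi
  have hX : (Polynomial.X : Polynomial (MvPolynomial (Fin 4) k)) ≠ 0 := Polynomial.X_ne_zero
  have hmain : (Phi D * (C Fq + Polynomial.X ^ 2 * C (MvPolynomial.X 0 * MvPolynomial.X 3 ^ 5)) -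
      Polynomial.X * K5) * Polynomial.X ^ 3 =
      (Phi P * C (MvPolynomial.X 0) + Phi Q * C (MvPolynomial.X 1) +
        Phi R₀ * C (MvPolynomial.X 3)) * Phi H := by
    apply mul_left_cancel₀ hX
    linear_combination hPhi
  -- abbreviations
  set QL : Polynomial (MvPolynomial (Fin 4) k) :=
    Phi D * (C Fq + Polynomial.X ^ 2 * C (MvPolynomial.X 0 * MvPolynomial.X 3 ^ 5)) -
      Polynomial.X * K5 with hQL
  set V : Polynomial (MvPolynomial (Fin 4) k) :=
    Phi P * C (MvPolynomial.X 0) + Phi Q * C (MvPolynomial.X 1) +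
      Phi R₀ * C (MvPolynomial.X 3) with hV
  have hQL0 : QL.coeff 0 = piX D * Fq := by
    rw [hQL]
    simp [Phi_coeff_zero]
  have hV0 : V.coeff 0 = piX P * MvPolynomial.X 0 + piX Q * MvPolynomial.X 1 +
      piX R₀ * MvPolynomial.X 3 := by
    rw [hV]
    simp [Phi_coeff_zero]
  have hQL0ne : QL.coeff 0 ≠ 0 := by
    rw [hQL0]
    exact mul_ne_zero hD0 hFq
  -- the linear initial form `L = V.coeff 0` of `a` is nonzero
  have hL : V.coeff 0 ≠ 0 := by
    rw [hV0]
    intro h0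
    apply hpqr
    refine ⟨?_, ?_, ?_⟩
    · have := congrArg (MvPolynomial.aeval (![1, 0, Polynomial.X, 0] : Fin 4 → Polynomial k)) h0
      simpa [aeval_piX_vec] using this
    · have := congrArg (MvPolynomial.aeval (![0, 1, Polynomial.X, 0] : Fin 4 → Polynomial k)) h0
      simpa [aeval_piX_vec] using this
    · have := congrArg (MvPolynomial.aeval (![0, 0, Polynomial.X, 1] : Fin 4 → Polynomial k)) h0
      simpa [aeval_piX_vec] using this
  have hQLne : QL ≠ 0 := fun h0 => hQL0ne (by rw [h0, Polynomial.coeff_zero])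
  have hVne : V ≠ 0 := fun h0 => hL (by rw [h0, Polynomial.coeff_zero])
  have hPhiH : Phi H ≠ 0 := by
    intro h0
    rw [h0, mul_zero] at hmain
    exact (mul_ne_zero hQLne (pow_ne_zero 3 hX)) hmain
  -- trailing degrees and coefficients: `piX D · Fq = L · M`
  have hntQL : QL.natTrailingDegree = 0 :=
    Nat.eq_zero_of_le_zero (Polynomial.natTrailingDegree_le_of_ne_zero hQL0ne)
  have hntV : V.natTrailingDegree = 0 :=
    Nat.eq_zero_of_le_zero (Polynomial.natTrailingDegree_le_of_ne_zero hL)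
  have htc := congrArg Polynomial.trailingCoeff hmain
  rw [Polynomial.trailingCoeff_mul, Polynomial.trailingCoeff_mul] at htc
  have e1 : QL.trailingCoeff = piX D * Fq := by
    rw [Polynomial.trailingCoeff, hntQL, hQL0]
  have e2 : (Polynomial.X ^ 3 : Polynomial (MvPolynomial (Fin 4) k)).trailingCoeff = 1 := by
    rw [Polynomial.trailingCoeff, Polynomial.natTrailingDegree_X_pow, Polynomial.coeff_X_pow_self]
  have e3 : V.trailingCoeff = piX P * MvPolynomial.X 0 + piX Q * MvPolynomial.X 1 +
      piX R₀ * MvPolynomial.X 3 := by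
    rw [Polynomial.trailingCoeff, hntV, hV0]
  rw [e1, e2, e3, mul_one] at htc
  -- kill `L` by a substitution fixing the `x`-line, keeping `Fq` and `piX D` alive
  by_cases hp0 : rho P = 0
  · by_cases hq0 : rho Q = 0
    · -- `L = (rho R₀) y`: substitute `y ↦ 0`, `z ↦ 1`
      have := congrArg (MvPolynomial.aeval (![0, 1, Polynomial.X, 0] : Fin 4 → Polynomial k)) htc
      simp [Fq, aeval_piX_vec, hp0, hq0] at this
      exact hd0 this
    · -- `L = (rho Q) z + (rho R₀) y`: substitute `z ↦ rho R₀`, `y ↦ -rho Q`, `s ↦ 0`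
      have := congrArg
        (MvPolynomial.aeval (![0, rho R₀, Polynomial.X, -rho Q] : Fin 4 → Polynomial k)) htc
      simp [Fq, aeval_piX_vec, hp0] at this
      have h4 : rho D * (rho R₀ ^ 4 + Polynomial.X ^ 2 * rho Q ^ 4) = 0 := by
        linear_combination this
      exact (mul_ne_zero hd0 (pow_four_add_X_sq_mul_pow_four_ne_zero hq0 (rho R₀))) h4
  · -- `rho P ≠ 0`: substitute `s ↦ -rho Q`, `z ↦ rho P`, `y ↦ 0`
    have := congrArg
      (MvPolynomial.aeval (![-rho Q, rho P, Polynomial.X, 0] : Fin 4 → Polynomial k)) htc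
    simp [Fq, aeval_piX_vec] at this
    have h4 : rho D * rho P ^ 4 = 0 := by
      linear_combination this
    exact (mul_ne_zero hd0 (pow_ne_zero 4 hp0)) h4

section LocalLine

variable (S : Type*) [CommRing S] [Algebra (MvPolynomial (Fin 4) k) S]

/-- **(B) core, localized.** In the local ring `S` of a `k`-point `c ∈ ℓ`: for every
`u₀ ∈ I_ℓ S` with `u₀ ∉ 𝔪²`, `g ∉ (u₀) + I_ℓ⁵ S`. -/
theorem algebraMap_gSpec_not_mem_span_sup (c : Fin 4 → k) (hc0 : c 0 = 0) (hc1 : c 1 = 0)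
    (hc3 : c 3 = 0) [IsLocalization.AtPrime S (pointIdeal k c)] [IsLocalRing S] {u₀ : S}
    (hu₀ : u₀ ∈ (lineIdeal k).map (algebraMap (MvPolynomial (Fin 4) k) S))
    (hu₀' : u₀ ∉ IsLocalRing.maximalIdeal S ^ 2) :
    algebraMap (MvPolynomial (Fin 4) k) S (gSpec k) ∉
      Ideal.span {u₀} ⊔ (lineIdeal k ^ 5).map (algebraMap (MvPolynomial (Fin 4) k) S) := by
  intro h
  obtain ⟨⟨⟨a, ha⟩, ⟨m0, hm0⟩⟩, hu⟩ :=
    (IsLocalization.mem_map_algebraMap_iff (pointIdeal k c).primeCompl S).mp hu₀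
  obtain ⟨y, hy, z, hz, hyz⟩ := Submodule.mem_sup.mp h
  obtain ⟨h', rfl⟩ := Ideal.mem_span_singleton'.mp hy
  obtain ⟨⟨⟨b, hb⟩, ⟨m2, hm2⟩⟩, hz'⟩ :=
    (IsLocalization.mem_map_algebraMap_iff (pointIdeal k c).primeCompl S).mp hz
  obtain ⟨⟨r1, ⟨m1, hm1⟩⟩, hr1⟩ := IsLocalization.surj (pointIdeal k c).primeCompl h'
  simp only at hu hz' hr1
  have key : algebraMap (MvPolynomial (Fin 4) k) S (m0 * m1 * m2 * gSpec k) =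
      algebraMap (MvPolynomial (Fin 4) k) S (r1 * m2 * a + m0 * m1 * b) := by
    simp only [map_mul, map_add, ← hu, ← hz', ← hr1, ← hyz]
    ring
  have hinj : Function.Injective (algebraMap (MvPolynomial (Fin 4) k) S) :=
    IsLocalization.injective S (Ideal.primeCompl_le_nonZeroDivisors (pointIdeal k c))
  have hR := hinj key
  have hev : ∀ m ∈ (pointIdeal k c).primeCompl, MvPolynomial.eval c m ≠ 0 := fun m hm h0 =>
    hm ((mem_pointIdeal_iff c m).mpr h0)
  refine gSpec_lineIdentity_false c hc0 hc1 hc3 (D := m0 * m1 * m2) (H := r1 * m2)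
    (R5 := m0 * m1 * b) ?_ ha ?_ (Ideal.mul_mem_left _ _ hb) hR
  · simp only [map_mul]
    exact mul_ne_zero (mul_ne_zero (hev m0 hm0) (hev m1 hm1)) (hev m2 hm2)
  · intro ha2
    apply hu₀'
    have h1 : algebraMap (MvPolynomial (Fin 4) k) S a ∈ IsLocalRing.maximalIdeal S ^ 2 := by
      rw [← IsLocalization.AtPrime.map_eq_maximalIdeal (pointIdeal k c) S, ← Ideal.map_pow]
      exact Ideal.mem_map_of_mem _ ha2
    obtain ⟨v, hv⟩ := IsLocalization.map_units S (⟨m0, hm0⟩ : (pointIdeal k c).primeCompl)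
    have hu' : u₀ = algebraMap (MvPolynomial (Fin 4) k) S a * ↑v⁻¹ := by
      rw [← hu, ← hv, mul_assoc, Units.mul_inv, mul_one]
    rw [hu']
    exact Ideal.mul_mem_right _ _ h1

/-- **(B) Twisted-line cap.** In the local ring of a `k`-point `c ∈ ℓ`: if `g` lies in the
degree-`d` weighted monomial ideal of a family `u` of elements of `I_ℓ S` (a chart whose support
contains `ℓ` near `c`), some member `u i₀` of which is not in `𝔪²` (as for any member of a regular
system of parameters), and `W` bounds the weights of the members OTHER than `u i₀`, then
`d ≤ 4 W`.  With `i₀` an index of maximal weight: the second-smallest profile entry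
`d / (max_{i ≠ i₀} wᵢ)` is `≤ 4`, so the profile of every `ℓ`-saturated chart through `g` is
`≤ (4; 4, …)`. -/
theorem gSpec_weightedMonomialIdeal_lineCap (c : Fin 4 → k) (hc0 : c 0 = 0) (hc1 : c 1 = 0)
    (hc3 : c 3 = 0) [IsLocalization.AtPrime S (pointIdeal k c)] [IsLocalRing S] {m : ℕ}
    (u : Fin m → S) (w : Fin m → ℕ) (d W : ℕ) (i₀ : Fin m)
    (hu : ∀ i, u i ∈ (lineIdeal k).map (algebraMap (MvPolynomial (Fin 4) k) S))
    (hu₀ : u i₀ ∉ IsLocalRing.maximalIdeal S ^ 2) (hw : ∀ i, i ≠ i₀ → w i ≤ W)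
    (hg : algebraMap (MvPolynomial (Fin 4) k) S (gSpec k) ∈ weightedMonomialIdeal u w d) :
    d ≤ 4 * W := by
  classical
  by_contra hd
  push Not at hd
  apply algebraMap_gSpec_not_mem_span_sup S c hc0 hc1 hc3 (hu i₀) hu₀
  have hle : weightedMonomialIdeal u w d ≤
      Ideal.span {u i₀} ⊔ (lineIdeal k ^ 5).map (algebraMap (MvPolynomial (Fin 4) k) S) := by
    refine Ideal.span_le.mpr ?_
    rintro x ⟨α, hα, rfl⟩
    by_cases hα0 : α i₀ = 0
    · apply Ideal.mem_sup_right
      rw [Ideal.map_pow]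
      have h1 : ∑ i, w i * α i ≤ W * ∑ i, α i := by
        rw [Finset.mul_sum]
        refine Finset.sum_le_sum fun i _ => ?_
        by_cases hi : i = i₀
        · subst hi
          simp [hα0]
        · exact Nat.mul_le_mul_right _ (hw i hi)
      have h5 : 5 ≤ ∑ i, α i := by
        by_contra h5
        push Not at h5
        have : W * ∑ i, α i ≤ W * 4 := Nat.mul_le_mul_left _ (by omega)
        omega
      exact Ideal.pow_le_pow_right h5
        (prod_pow_mem_pow_sum S Finset.univ _ u α fun i _ => hu i)
    · apply Ideal.mem_sup_left
      rw [← Finset.mul_prod_erase Finset.univ (fun i => u i ^ α i) (Finset.mem_univ i₀)]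
      obtain ⟨n, hn⟩ := Nat.exists_eq_succ_of_ne_zero hα0
      simp only [hn, pow_succ', mul_assoc]
      exact Ideal.mul_mem_right _ _ (Ideal.mem_span_singleton_self _)
  exact hle hg

end LocalLine

end Summit.ResolutionOfSingularities.ResolutionOfSingularities.Theorems.WeightedConstruction.Negative.SpecimenGerms

end
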